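import Mathlib
import HarnessLib
import Summits.NavierStokesRegularity.NavierStokesRegularity.Theorems.TypeILiouvilleShorelineAnalytic

/-!
# TypeILiouvilleRecurrentSliceSieve — crux (L) stmt-NavierStokesRegularity-10661 `TypeIliouvilleL`:
# THE FADING DOORS ARE BLIND TO EVERY FLOW WITH ONE α-RECURRENT SLICE (one-slice, pointwise form of the steady sieve)

Helper for stmt-NavierStokesRegularity-10661 (`--supports`); theorems only, no definitions, no named-fact
hypotheses; closes no item; Navier–Stokes regularity is NOT proved here (leafhand seat of the EulerZoomLiouville
route).  Class P = print's class of bounded ancient mild solutions (`v : ℝ → ℝ³ → ℝ³` continuous and bounded on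
`(−∞,0) × ℝ³`, weakly divergence free, `v(t) = e^{(t−s)Δ}v(s) − B¹_s(v,v)(t)` for `s < t < 0`).

The steady sieve (`TypeILiouvilleSteadySieve`, decomp-ns lens-2 g24) proved that the registered residual L_Q
(`stub_quiescentLiouville`) and the door BCL hold OUTRIGHT on UNIFORMLY RECURRENT pasts (every slice recurs in sup
norm), by metric chaining.  The recurrence actually needed is ONE SLICE, POINTWISE, ALONG ONE SEQUENCE:
say the slice `v(t₀)` (`t₀ < 0`) is α-RECURRENT if `v(s_k, x) → v(t₀, x)` for every `x` along some `s_k → −∞`.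

* §1 `slice_const_of_quiescent_alphaRecurrent` — quiescent past + α-recurrent slice ⟹ that slice is constant on
  unit balls, hence (class P: one locally constant slice propagates, `classP_const_of_locallyConst_slice`) the flow
  is ONE constant vector: `const_of_quiescent_alphaRecurrentSlice`.
* §2 `const_of_backwardConvergent_alphaRecurrentSlice` — backward convergence to a stream `c` + α-recurrent slice
  ⟹ `v ≡ c` (the slice IS `c`; no PDE beyond one-slice rigidity).
* §3 by-name readings: `quiescentLiouville_onAlphaRecurrentSlice` (binders of the registered L_Q verbatim + one
  α-recurrent slice), `bcl_onAlphaRecurrentSlice`.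

READING (with `TypeILiouvilleRecurrentEternalBridge` §5: under EL one α-recurrent slice forces constancy): the dial
«does some slice recur in the past, even pointwise along a subsequence?» splits every class-P flow; on the recurrent
side L_Q / BCL / LSL hold outright and (L) is exactly ETERNAL LIOUVILLE's business; the open cores of L_Q, BCL, LSL
(and all of SQL) consist of TOTALLY TRANSIENT pasts — no slice is a pointwise α-limit of earlier slices.
[cite: KochNadirashviliSereginSverak2009, §1 p. 3, Remark 6.1 (arXiv:0709.3599); LemarieRieusset2016, Thm. 9.12 (PDF p. 260)]
-/

noncomputable section

open MeasureTheory Filter Set Function Metric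
open scoped Topology
open Literature.Analysis Literature.Analysis.FluidPDE Literature.Analysis.UnboundedOperators
open Summit.NavierStokesRegularity.NavierStokesRegularity.Theorems.TypeILiouvilleShoreline

set_option linter.dupNamespace false

namespace Summit.NavierStokesRegularity.NavierStokesRegularity.Theorems.TypeILiouvilleRecurrentSliceSieve

variable {v : ℝ → EuclideanSpace ℝ (Fin 3) → EuclideanSpace ℝ (Fin 3)}

/-! ## §1 Quiescent + one α-recurrent slice -/

/-- **Quiescent past + α-recurrent slice ⟹ the slice has zero unit-scale oscillation** (pure limit argument, no
PDE): `‖v(t₀,x) − v(t₀,y)‖ = lim ‖v(s_k,x) − v(s_k,y)‖ ≤ ε` for every `ε > 0` when `dist x y ≤ 1`. [folklore] -/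
theorem slice_const_of_quiescent_alphaRecurrent
    (hq : ∀ ε : ℝ, 0 < ε → ∃ T : ℝ, T < 0 ∧ ∀ t < T, ∀ x y : EuclideanSpace ℝ (Fin 3),
      dist x y ≤ 1 → ‖v t x - v t y‖ ≤ ε)
    {t₀ : ℝ} {s : ℕ → ℝ} (hs : Tendsto s atTop atBot)
    (hlim : ∀ x, Tendsto (fun k => v (s k) x) atTop (𝓝 (v t₀ x))) :
    ∀ x y : EuclideanSpace ℝ (Fin 3), dist x y ≤ 1 → v t₀ x = v t₀ y := by
  intro x y hxy
  have hle : ∀ ε : ℝ, 0 < ε → ‖v t₀ x - v t₀ y‖ ≤ ε := by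
    intro ε hε
    obtain ⟨T, -, hT⟩ := hq ε hε
    have hev : ∀ᶠ k in atTop, ‖v (s k) x - v (s k) y‖ ≤ ε := by
      filter_upwards [hs.eventually (eventually_lt_atBot T)] with k hk using hT (s k) hk x y hxy
    exact le_of_tendsto (((hlim x).sub (hlim y)).norm) hev
  have h0 : ‖v t₀ x - v t₀ y‖ ≤ 0 :=
    le_of_forall_pos_le_add fun ε hε => by rw [zero_add]; exact hle ε hε
  exact sub_eq_zero.1 (norm_le_zero_iff.1 h0)

/-- **QUIESCENT + ONE α-RECURRENT SLICE ⟹ ONE CONSTANT VECTOR** (class P): the recurrent slice is constant on the unit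
ball about the origin (§1), and one locally constant slice propagates to the whole slab
(`classP_const_of_locallyConst_slice`: forward uniqueness, backward time-analyticity). Generalizes the steady sieve's
`quiescentLiouville_onRecurrent` (all slices, sup norm) to one slice, pointwise, one sequence.
[cite: LemarieRieusset2016, Thm. 9.12 (PDF p. 260); KochNadirashviliSereginSverak2009, Remark 6.1 (arXiv:0709.3599)] -/
theorem const_of_quiescent_alphaRecurrentSlice
    (hc : ContinuousOn (uncurry v) (Iio 0 ×ˢ univ))
    (hK : ∃ K : ℝ, ∀ t < 0, ∀ x, ‖v t x‖ ≤ K)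
    (hm : ∀ s t : ℝ, s < t → t < 0 → ∀ x,
      v t x = heatExtension (v s) (t - s) x - oseenDuhamel 1 s v v t x)
    (hq : ∀ ε : ℝ, 0 < ε → ∃ T : ℝ, T < 0 ∧ ∀ t < T, ∀ x y : EuclideanSpace ℝ (Fin 3),
      dist x y ≤ 1 → ‖v t x - v t y‖ ≤ ε)
    {t₀ : ℝ} (ht₀ : t₀ < 0) {s : ℕ → ℝ} (hs : Tendsto s atTop atBot)
    (hlim : ∀ x, Tendsto (fun k => v (s k) x) atTop (𝓝 (v t₀ x))) :
    ∃ b : EuclideanSpace ℝ (Fin 3), ∀ t < 0, ∀ x, v t x = b := by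
  have hball : ∀ x ∈ ball (0 : EuclideanSpace ℝ (Fin 3)) 1, v t₀ x = v t₀ 0 := fun x hx =>
    slice_const_of_quiescent_alphaRecurrent hq hs hlim x 0 (mem_ball.1 hx).le
  exact ⟨v t₀ 0, classP_const_of_locallyConst_slice hc hK hm ht₀ isOpen_ball ⟨0, mem_ball_self one_pos⟩ hball⟩

/-! ## §2 Backward convergent + one α-recurrent slice -/

/-- **BACKWARD CONVERGENCE TO A STREAM `c` + ONE α-RECURRENT SLICE ⟹ `v ≡ c`**: the recurrent slice is the
pointwise limit of slices converging uniformly to `c`, so it IS `c`, and one constant slice propagates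
(`classP_const_of_locallyConst_slice`). Generalizes the steady sieve's `bcl_onRecurrent`. [cite: LemarieRieusset2016, Thm. 9.12 (PDF p. 260)] -/
theorem const_of_backwardConvergent_alphaRecurrentSlice
    (hc : ContinuousOn (uncurry v) (Iio 0 ×ˢ univ))
    (hK : ∃ K : ℝ, ∀ t < 0, ∀ x, ‖v t x‖ ≤ K)
    (hm : ∀ s t : ℝ, s < t → t < 0 → ∀ x,
      v t x = heatExtension (v s) (t - s) x - oseenDuhamel 1 s v v t x)
    {c : EuclideanSpace ℝ (Fin 3)}
    (hconv : ∀ η : ℝ, 0 < η → ∃ T : ℝ, T < 0 ∧ ∀ t < T, ∀ x, ‖v t x - c‖ ≤ η)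
    {t₀ : ℝ} (ht₀ : t₀ < 0) {s : ℕ → ℝ} (hs : Tendsto s atTop atBot)
    (hlim : ∀ x, Tendsto (fun k => v (s k) x) atTop (𝓝 (v t₀ x))) :
    ∀ t < 0, ∀ x, v t x = c := by
  have hslice : ∀ x ∈ (univ : Set (EuclideanSpace ℝ (Fin 3))), v t₀ x = c := by
    intro x _
    have hc' : Tendsto (fun k => v (s k) x) atTop (𝓝 c) := by
      rw [tendsto_iff_norm_sub_tendsto_zero]
      refine Metric.tendsto_atTop.2 fun η hη => ?_
      obtain ⟨T, -, hT⟩ := hconv (η / 2) (half_pos hη)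
      obtain ⟨N, hN⟩ := eventually_atTop.1 (hs.eventually (eventually_lt_atBot T))
      refine ⟨N, fun k hk => ?_⟩
      rw [dist_zero_right, Real.norm_of_nonneg (norm_nonneg _)]
      exact (hT (s k) (hN k hk) x).trans_lt (half_lt_self hη)
    exact tendsto_nhds_unique (hlim x) hc'
  exact classP_const_of_locallyConst_slice hc hK hm ht₀ isOpen_univ univ_nonempty hslice

/-! ## §3 Readings on the registered residual L_Q and the door BCL -/

/-- **L_Q (registered `stub_quiescentLiouville`) HOLDS OUTRIGHT on every class-P flow with ONE α-recurrent slice**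
(binders of the stub verbatim, plus the recurrent slice; weak divergence-freeness is not even used).
[cite: KochNadirashviliSereginSverak2009, §1 p. 3 (arXiv:0709.3599)] -/
theorem quiescentLiouville_onAlphaRecurrentSlice :
    ∀ v : ℝ → EuclideanSpace ℝ (Fin 3) → EuclideanSpace ℝ (Fin 3),
      ContinuousOn (Function.uncurry v) (Set.Iio 0 ×ˢ Set.univ) →
      (∃ K : ℝ, ∀ t < 0, ∀ x, ‖v t x‖ ≤ K) →
      (∀ t < 0, Literature.Analysis.FluidPDE.IsWeaklyDivFree (v t)) →
      (∀ s t : ℝ, s < t → t < 0 → ∀ x,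
        v t x = Literature.Analysis.UnboundedOperators.heatExtension (v s) (t - s) x -
          Literature.Analysis.FluidPDE.oseenDuhamel 1 s v v t x) →
      (∀ ε : ℝ, 0 < ε → ∃ T : ℝ, T < 0 ∧ ∀ t < T, ∀ x y : EuclideanSpace ℝ (Fin 3),
        dist x y ≤ 1 → ‖v t x - v t y‖ ≤ ε) →
      (∃ (t₀ : ℝ) (s : ℕ → ℝ), t₀ < 0 ∧ Tendsto s atTop atBot ∧
        ∀ x, Tendsto (fun k => v (s k) x) atTop (𝓝 (v t₀ x))) →
      ∃ b : EuclideanSpace ℝ (Fin 3), ∀ t < 0, ∀ x, v t x = b := by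
  intro v hc hK _ hm hq hrec
  obtain ⟨t₀, s, ht₀, hs, hlim⟩ := hrec
  exact const_of_quiescent_alphaRecurrentSlice hc hK hm hq ht₀ hs hlim

/-- **BCL (backward-convergent Liouville) HOLDS OUTRIGHT on every class-P flow with ONE α-recurrent slice** (binders
of the door as typed in `TypeILiouvilleGlobalFading`, plus the recurrent slice). [cite: KochNadirashviliSereginSverak2009, §1 p. 3 (arXiv:0709.3599)] -/
theorem bcl_onAlphaRecurrentSlice :
    ∀ v : ℝ → EuclideanSpace ℝ (Fin 3) → EuclideanSpace ℝ (Fin 3),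
      ContinuousOn (uncurry v) (Iio 0 ×ˢ univ) →
      (∃ K : ℝ, ∀ t < 0, ∀ x, ‖v t x‖ ≤ K) →
      (∀ t < 0, Literature.Analysis.FluidPDE.IsWeaklyDivFree (v t)) →
      (∀ s t : ℝ, s < t → t < 0 → ∀ x,
        v t x = Literature.Analysis.UnboundedOperators.heatExtension (v s) (t - s) x -
          Literature.Analysis.FluidPDE.oseenDuhamel 1 s v v t x) →
      (∃ c : EuclideanSpace ℝ (Fin 3), ∀ η : ℝ, 0 < η → ∃ T : ℝ, T < 0 ∧ ∀ t < T, ∀ x,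
        ‖v t x - c‖ ≤ η) →
      (∃ (t₀ : ℝ) (s : ℕ → ℝ), t₀ < 0 ∧ Tendsto s atTop atBot ∧
        ∀ x, Tendsto (fun k => v (s k) x) atTop (𝓝 (v t₀ x))) →
      ∃ b : EuclideanSpace ℝ (Fin 3), ∀ t < 0, ∀ x, v t x = b := by
  intro v hc hK _ hm hconv hrec
  obtain ⟨c, hconv⟩ := hconv
  obtain ⟨t₀, s, ht₀, hs, hlim⟩ := hrec
  exact ⟨c, const_of_backwardConvergent_alphaRecurrentSlice hc hK hm hconv ht₀ hs hlim⟩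

end Summit.NavierStokesRegularity.NavierStokesRegularity.Theorems.TypeILiouvilleRecurrentSliceSieve

end
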